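import Summits.QuantumFields.YangMills.Theorems.BalabanUVNodesN15PerCubeGreenTwoGridKnitDefectSummand
import HarnessLib

/-!
# N15 = NE2, road (c) — PROGRAMME (PC), (PC-E-N): THE TWO GLUED SCALAR COVARIANT GREEN's FUNCTIONS OF THE PAIR ARE TWO-SIDED INVERSES — decay + BOTH inverse identities on BOTH
# grids for the SAME per-cube gauges, from the POINTWISE (3.35) letters of n15-c∕340 (dag-n15-c g35, n15-c∕387)

Cell `pub-ymgap`, seat `pub-ymgap-dag-n15-c` (generation g35; R134 (a) seat, strategy s1 «first missing estimate»; HUMAN RULING D-0062; chair R424 venue).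
`bears_on: R4∕N15 · K3⁸ SpineGivenEndpointR13SepCoPHV (stmt-QuantumFields-27366)`; filed `--kind proof --supports stmt-QuantumFields-27366 --as helper` — COUNT-NEUTRAL.
ONE theorem, 0 `def`, 0 `sorry`; bookkeeping over landed rows, NO new estimate.  Imports BY NAME n15-c∕340 `…PerCubeGreenTwoGridKnitDefectSummand` (and through it n15-c∕262
`…PerCubeGreenKnit` (`uN_scGlued_spec`), n15-c∕262′ `…PerCubeGreenFineKnit` (`uN_scGlued'_spec`), n15-c∕265∕265′ `…PerCubeGreen(Fine)Covariant` (`scP_conj`, `scP'_conj`,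
`hasMaj_scNV(′)_cut_of_rows`, `one_sub_scPsi(′)_comp_scNV(′)_comp_scChi(′)`), dag-n15-w2 `CurvedSpecies` (`rowSum_tCoefA_inl∕inr_le_at`, `rowSum_tCoefC_le_at`,
`uN_abs_coordMat_conj_sub_one∕conj_entry_le_op`, `uN_coordMat_conj_orthogonal`, `uN_gaugeTransformed_bond_unitary`)); nothing in the tree is modified, no landed name re-declared.

WHY (the (PC-E-N) programme).  The (PC-E) rate theorems for entries 0 (n15-c∕374∕375) and 3 (n15-c∕386) of (3.42) each conclude `∃ u′ …` — the per-cube gauges are CHOSEN inside the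
proof, so the two theorems speak about two opaque gauge systems, while the node's readout (n15-b `OperatorReadout.ne2PlusOperator_of_hasMaj`) wants ONE operator `G′(U)` with four
entries.  The glued operator `scGlued(′) … w U P N_V` IS the two-sided inverse of Bałaban's `Δ_{R_U} + a·Q′_TᵀQ′_T` (262∕262′), and two-sided inverses are unique; THIS file supplies
the inverse identities for the SAME gauges `u′_k` (fine) ∕ `u′_k∘σ` (coarse, INDUCED through King's section) and the SAME hypotheses under which 340 states the two-grid η-defect, so
that every (PC-E) conclusion can be restated for THE inverse `invOp (Δ_{R_U} + P)` (n15-c∕388) with NO `∃ u′` (n15-c∕389 ff.).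

THE THEOREM `uN_scGreen_specPair_tr`.  For odd `L ≥ 7`, `a₀ > 0`, a colour index `ι`: there are `δ, w₀, R₀, B > 0` such that on every doubled torus of the cover (`k ≥ 1`, `L^m ≥ w₀`),
every refinement `r ≥ 1`, for trace-form coordinates `e` of `M_m(ℂ)`, unitary fine cube gauges `u′_k`, unitary bond fields `U` (coarse) ∕ `U′` (fine), sets `Qf k` ⊇ the fine cut box
and its `−e′_μ` neighbours, `Qc k` ⊇ the coarse cut box and its `−e_μ` neighbours, pointwise letters `p, q` of the transformed bond variables (340's four displayed clauses VERBATIM)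
and 340's numeric thresholds `hrA hrC hRle` VERBATIM: BOTH `G′(U) := scGlued … (u′∘σ) U (scP U) (scNV (u′∘σ) U)` and `G′(U′) := scGlued′ … u′ U′ (scP′ U′) (scNV′ u′ U′)` decay
`≤ B·e^{−(δ∕16)|y−y′|_T}` blockwise AND are two-sided inverses of `Δ_{R_U} + a·Q′_TᵀQ′_T` (coarse, King's mass `a_K(a₀,L,k)·(L^k)^{d+1}`) ∕ `Δ_{R_U′} + a′·Q′_TᵀQ′_T` (fine, mass
`a_K(a₀,L,r+k)·(L^rL^k)^{d+1}`).  PROOF = 340's own derivation of 262∕262′'s rows from the pointwise letters (entry letters → coefficient row sums; cut rows of `N_V`; the tails VANISH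
on sites) followed by ONE call of 262 and ONE of 262′; `δ := min`, `w₀ := max`, `R₀ := min`, `B := max` of the two constant blocks.

HONEST FRAMING ∕ LIMITS.  Bookkeeping over the MODEL glued propagator on MODEL carriers; the displayed hypotheses are the paper's small-field hypotheses in the CUBE GAUGES; nothing of
[B5]∕[B6]∕[B9] asserted.  NE2⁺ NOT PRINTED, NOT proved; N15 of record untouched (DISCHARGED AS CONSUMED, p687738); K3⁸ OPEN; counts of record UNMOVED (typed 28∕28 · discharged 8∕27);
one finite 𝕋⁴ at fixed ε per index — NOT infinite volume, NOT OS on ℝ⁴, NOT a mass gap, NOT Clay.  Restate-immune (no Theses import).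
-/

noncomputable section

open scoped BigOperators Matrix Matrix.Norms.L2Operator

namespace Summit.QuantumFields.YangMills.BalabanUVNodes.N15.Gluing

open Real
open Literature.MathematicalPhysics.QuantumFieldTheory.Balaban1983to89
open Literature.MathematicalPhysics.QuantumFieldTheory.Balaban1983to89.B5Prop11Plancherel (Tor fine unitVec)
open Literature.MathematicalPhysics.QuantumFieldTheory.Balaban1983to89.B11SectG (BlockNorm HasMaj hasMaj_zero)
open Literature.MathematicalPhysics.QuantumFieldTheory.Balaban1983to89.T4EtaRateDefect (idef idef_zero)
open Literature.MathematicalPhysics.QuantumFieldTheory.Balaban1983to89.T4EtaRateCoeffDefect (pull)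
open Literature.MathematicalPhysics.QuantumFieldTheory.Balaban1983to89.B6Prop26Gluing (mulOp mulOp_apply ind ind_nonneg)
open Literature.MathematicalPhysics.QuantumFieldTheory.Balaban1983to89.B6UnitTorusCarrier (unitTorusGeo unitTorusGeo_dist_nonneg)
open Literature.MathematicalPhysics.QuantumFieldTheory.Balaban1983to89.B5SiteBridgeP12 (MP)
open Literature.MathematicalPhysics.QuantumFieldTheory.King1986 (aK aK_pos aK_le)
open Literature.MathematicalPhysics.QuantumFieldTheory.King1986.Torus (blockOf)
open Literature.Barriers.QuantumFields (traceForm)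
open Summit.QuantumFields.YangMills.BalabanUVNodes.N15.BackgroundLayer (covLapM tCoefA tCoefC)
open Summit.QuantumFields.YangMills.BalabanUVNodes.N15.VectorPiece (kingPr)
open Summit.QuantumFields.YangMills.BalabanUVNodes.N15.MatrixSpecies (mmulOp coordMat basisConst basisConst_nonneg liftBlk liftMap liftEquiv)
open Summit.QuantumFields.YangMills.BalabanUVNodes.N15.TwoGrid (chiCube cubeBlocks)
open Summit.QuantumFields.YangMills.BalabanUVNodes.N15.CurvedSpecies (gaugePair rowSum_tCoefA_inl_le_at rowSum_tCoefA_inr_le_at rowSum_tCoefC_le_at uN_abs_coordMat_conj_sub_one_entry_le_op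
  uN_abs_coordMat_conj_sub_conj_entry_le_op uN_coordMat_conj_orthogonal uN_gaugeTransformed_bond_unitary)
open Summit.QuantumFields.YangMills.BalabanUVNodes.N15.CovLandau (csavg)
open Summit.QuantumFields.YangMills.BalabanUVNodes.N15.CovAvg (kingSec ctauS)

variable {d : ℕ}

section Green

variable {L : ℕ} [NeZero L]

set_option maxHeartbeats 800000 in
/-- ★★★ **THE GLUED SCALAR COVARIANT GREEN's FUNCTIONS OF THE PAIR DECAY AND ARE TWO-SIDED INVERSES — same gauges, same hypotheses as n15-c∕340.**  See the module docstring.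
MODEL carriers; the SHAPE of [B9] Thm 3.7 ∕ Cor. 3.6 ∕ (3.42)₀ for `G′(U)`, NOT the printed theorems.
[cite: Balaban1985BackgroundPropagators, Thm 3.7 (3.90) p.409, Cor. 3.6 p.408, (3.24)–(3.25) p.394, (3.34)–(3.35) p.396, (3.62)–(3.65) pp.402–403; Balaban1984PropagatorsII, (2.91)–(2.93) p.239] -/
theorem uN_scGreen_specPair_tr (hL : Odd L ∧ 1 < L) (hL7 : 7 ≤ L) {a₀ : ℝ} (ha₀ : 0 < a₀) (ι : Type) [Fintype ι] [DecidableEq ι] :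
    ∃ δ w₀ R₀ B : ℝ, 0 < δ ∧ 0 < R₀ ∧ 0 < B ∧ ∀ (mv kk r : ℕ), 1 ≤ kk → 1 ≤ r → w₀ ≤ ((L ^ mv : ℕ) : ℝ) →
      ∀ {mm : Type} [Fintype mm] [DecidableEq mm] [Nonempty mm] (e : Matrix mm mm ℂ ≃L[ℝ] (ι → ℝ)), (∀ A B : Matrix mm mm ℂ, traceForm A B = e A ⬝ᵥ e B) →
      ∀ (u' : (Fin (d + 1) → ZMod (2 * L)) → ScX' d L mv kk r hL → Matrix mm mm ℂ), (∀ k x', (u' k x')ᴴ * u' k x' = 1) →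
      ∀ (U : Fin (d + 1) → ScX d L mv kk hL → Matrix mm mm ℂ), (∀ μ x, (U μ x)ᴴ * U μ x = 1) → ∀ (U' : Fin (d + 1) → ScX' d L mv kk r hL → Matrix mm mm ℂ), (∀ μ x', (U' μ x')ᴴ * U' μ x' = 1) →
      ∀ (Qf : (Fin (d + 1) → ZMod (2 * L)) → Set (ScX' d L mv kk r hL)) (Qc : (Fin (d + 1) → ZMod (2 * L)) → Set (ScX d L mv kk hL)) (p q : ℝ), 0 ≤ p → 0 ≤ q →
        (∀ k x', scChi' d L mv kk r hL k x' ≠ 0 → x' ∈ Qf k ∧ ∀ μ, (scShift' d L mv kk r hL μ).symm x' ∈ Qf k) →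
        (∀ k x, scChi d L mv kk hL k x ≠ 0 → x ∈ Qc k ∧ ∀ μ, (scShift d L mv kk hL μ).symm x ∈ Qc k) →
        -- the POINTWISE (3.35) letters of the transformed bond variables: fine, in the cube gauge `u′_k`, on `Qf k`
        (∀ k μ z, z ∈ Qf k → ‖(u' k z * U' μ z * (u' k (scShift' d L mv kk r hL μ z))ᴴ) - 1‖ ≤ ((((L ^ r * L ^ kk : ℕ) : ℝ))⁻¹) * p) →
        (∀ k μ z, z ∈ Qf k → ‖(u' k z * U' μ z * (u' k (scShift' d L mv kk r hL μ z))ᴴ) - (u' k ((scShift' d L mv kk r hL μ).symm z) * U' μ ((scShift' d L mv kk r hL μ).symm z) * (u' k (scShift' d L mv kk r hL μ ((scShift' d L mv kk r hL μ).symm z)))ᴴ)‖ ≤ ((((L ^ r * L ^ kk : ℕ) : ℝ))⁻¹) ^ 2 * q) →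
        -- … and coarse, in the INDUCED gauge `u′_k∘σ`, on `Qc k` (the covariant fit of the PAIRING, displayed)
        (∀ k μ x, x ∈ Qc k → ‖(u' k (kingSec (cvM d L mv kk hL) L kk r x) * U μ x * (u' k (kingSec (cvM d L mv kk hL) L kk r (scShift d L mv kk hL μ x)))ᴴ) - 1‖ ≤ ((((L ^ kk : ℕ) : ℝ))⁻¹) * p) →
        (∀ k μ x, x ∈ Qc k → ‖(u' k (kingSec (cvM d L mv kk hL) L kk r x) * U μ x * (u' k (kingSec (cvM d L mv kk hL) L kk r (scShift d L mv kk hL μ x)))ᴴ) - (u' k (kingSec (cvM d L mv kk hL) L kk r ((scShift d L mv kk hL μ).symm x)) * U μ ((scShift d L mv kk hL μ).symm x) * (u' k (kingSec (cvM d L mv kk hL) L kk r (scShift d L mv kk hL μ ((scShift d L mv kk hL μ).symm x))))ᴴ)‖ ≤ ((((L ^ kk : ℕ) : ℝ))⁻¹) ^ 2 * q) →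
      ∀ (rV : ℝ), 0 ≤ rV →
        Fintype.card ι * (@basisConst ι _ (Matrix mm mm ℂ) Matrix.frobeniusNormedAddCommGroup Matrix.frobeniusNormedSpace e * (2 * Real.sqrt (Fintype.card mm)) * (Real.sqrt (Fintype.card mm) * p)) ≤ rV → Fintype.card ι * (Fintype.card (Fin (d + 1)) * (Fintype.card ι * (@basisConst ι _ (Matrix mm mm ℂ) Matrix.frobeniusNormedAddCommGroup Matrix.frobeniusNormedSpace e * (2 * Real.sqrt (Fintype.card mm)) * (Real.sqrt (Fintype.card mm) * p)) ^ 2 + (@basisConst ι _ (Matrix mm mm ℂ) Matrix.frobeniusNormedAddCommGroup Matrix.frobeniusNormedSpace e * (2 * Real.sqrt (Fintype.card mm)) * (Real.sqrt (Fintype.card mm) * q)))) ≤ rV →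
        rV * (1 + Fintype.card (Fin (d + 1) ⊕ Fin (d + 1))) + (a₀ * (Fintype.card ι * (Fintype.card ι * ((1 + rV * ((((L ^ kk : ℕ) : ℝ))⁻¹)) ^ ((d + 1) * L ^ kk) - 1) ^ 2 + 2 * ((1 + rV * ((((L ^ kk : ℕ) : ℝ))⁻¹)) ^ ((d + 1) * L ^ kk) - 1))) + a₀ * (Fintype.card ι * (Fintype.card ι * ((1 + rV * ((((L ^ r * L ^ kk : ℕ) : ℝ))⁻¹)) ^ ((d + 1) * (L ^ r * L ^ kk)) - 1) ^ 2 + 2 * ((1 + rV * ((((L ^ r * L ^ kk : ℕ) : ℝ))⁻¹)) ^ ((d + 1) * (L ^ r * L ^ kk)) - 1)))) ≤ R₀ →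
      -- COARSE: `G′(U)` in the INDUCED gauges decays and inverts `Δ_{R_U} + a·Q′_TᵀQ′_T` on both sides
      (HasMaj (ScNorm d L mv kk hL ι) (ScNorm d L mv kk hL ι) (scGlued d L mv kk hL (aK a₀ (L : ℝ) kk * (((L ^ kk : ℕ) : ℝ)) ^ (d + 1)) ((((L ^ kk : ℕ) : ℝ))⁻¹) ι e (fun k x => u' k (kingSec (cvM d L mv kk hL) L kk r x)) U (scP d L mv kk hL (aK a₀ (L : ℝ) kk * (((L ^ kk : ℕ) : ℝ)) ^ (d + 1)) ι e U) (scNV d L mv kk hL (aK a₀ (L : ℝ) kk * (((L ^ kk : ℕ) : ℝ)) ^ (d + 1)) ι e (fun k x => u' k (kingSec (cvM d L mv kk hL) L kk r x)) U))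
          (fun y y' => B * Real.exp (-(δ / 16 * (unitTorusGeo L kk (cvM d L mv kk hL)).dist y y'))) ∧
        scGlued d L mv kk hL (aK a₀ (L : ℝ) kk * (((L ^ kk : ℕ) : ℝ)) ^ (d + 1)) ((((L ^ kk : ℕ) : ℝ))⁻¹) ι e (fun k x => u' k (kingSec (cvM d L mv kk hL) L kk r x)) U (scP d L mv kk hL (aK a₀ (L : ℝ) kk * (((L ^ kk : ℕ) : ℝ)) ^ (d + 1)) ι e U) (scNV d L mv kk hL (aK a₀ (L : ℝ) kk * (((L ^ kk : ℕ) : ℝ)) ^ (d + 1)) ι e (fun k x => u' k (kingSec (cvM d L mv kk hL) L kk r x)) U) ∘ₗ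
            (covLapM (scShift d L mv kk hL) ((((L ^ kk : ℕ) : ℝ))⁻¹) (gaugePair (scShift d L mv kk hL) (fun μ x => coordMat e (ContinuousLinearMap.mulLeftRight ℝ (Matrix mm mm ℂ) (U μ x) (U μ x)ᴴ))) + scP d L mv kk hL (aK a₀ (L : ℝ) kk * (((L ^ kk : ℕ) : ℝ)) ^ (d + 1)) ι e U) = LinearMap.id ∧
        (covLapM (scShift d L mv kk hL) ((((L ^ kk : ℕ) : ℝ))⁻¹) (gaugePair (scShift d L mv kk hL) (fun μ x => coordMat e (ContinuousLinearMap.mulLeftRight ℝ (Matrix mm mm ℂ) (U μ x) (U μ x)ᴴ))) + scP d L mv kk hL (aK a₀ (L : ℝ) kk * (((L ^ kk : ℕ) : ℝ)) ^ (d + 1)) ι e U) ∘ₗ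
            scGlued d L mv kk hL (aK a₀ (L : ℝ) kk * (((L ^ kk : ℕ) : ℝ)) ^ (d + 1)) ((((L ^ kk : ℕ) : ℝ))⁻¹) ι e (fun k x => u' k (kingSec (cvM d L mv kk hL) L kk r x)) U (scP d L mv kk hL (aK a₀ (L : ℝ) kk * (((L ^ kk : ℕ) : ℝ)) ^ (d + 1)) ι e U) (scNV d L mv kk hL (aK a₀ (L : ℝ) kk * (((L ^ kk : ℕ) : ℝ)) ^ (d + 1)) ι e (fun k x => u' k (kingSec (cvM d L mv kk hL) L kk r x)) U) = LinearMap.id) ∧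
      -- FINE: `G′(U′)` in the gauges `u′_k` decays and inverts `Δ_{R_U′} + a′·Q′_TᵀQ′_T` on both sides
      (HasMaj (ScNorm' d L mv kk r hL ι) (ScNorm' d L mv kk r hL ι) (scGlued' d L mv kk r hL (aK a₀ (L : ℝ) (r + kk) * (((L ^ r * L ^ kk : ℕ) : ℝ)) ^ (d + 1)) ((((L ^ r * L ^ kk : ℕ) : ℝ))⁻¹) ι e u' U' (scP' d L mv kk r hL (aK a₀ (L : ℝ) (r + kk) * (((L ^ r * L ^ kk : ℕ) : ℝ)) ^ (d + 1)) ι e U') (scNV' d L mv kk r hL (aK a₀ (L : ℝ) (r + kk) * (((L ^ r * L ^ kk : ℕ) : ℝ)) ^ (d + 1)) ι e u' U'))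
          (fun y y' => B * Real.exp (-(δ / 16 * (unitTorusGeo L kk (cvM d L mv kk hL)).dist y y'))) ∧
        scGlued' d L mv kk r hL (aK a₀ (L : ℝ) (r + kk) * (((L ^ r * L ^ kk : ℕ) : ℝ)) ^ (d + 1)) ((((L ^ r * L ^ kk : ℕ) : ℝ))⁻¹) ι e u' U' (scP' d L mv kk r hL (aK a₀ (L : ℝ) (r + kk) * (((L ^ r * L ^ kk : ℕ) : ℝ)) ^ (d + 1)) ι e U') (scNV' d L mv kk r hL (aK a₀ (L : ℝ) (r + kk) * (((L ^ r * L ^ kk : ℕ) : ℝ)) ^ (d + 1)) ι e u' U') ∘ₗ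
            (covLapM (scShift' d L mv kk r hL) ((((L ^ r * L ^ kk : ℕ) : ℝ))⁻¹) (gaugePair (scShift' d L mv kk r hL) (fun μ x => coordMat e (ContinuousLinearMap.mulLeftRight ℝ (Matrix mm mm ℂ) (U' μ x) (U' μ x)ᴴ))) + scP' d L mv kk r hL (aK a₀ (L : ℝ) (r + kk) * (((L ^ r * L ^ kk : ℕ) : ℝ)) ^ (d + 1)) ι e U') = LinearMap.id ∧
        (covLapM (scShift' d L mv kk r hL) ((((L ^ r * L ^ kk : ℕ) : ℝ))⁻¹) (gaugePair (scShift' d L mv kk r hL) (fun μ x => coordMat e (ContinuousLinearMap.mulLeftRight ℝ (Matrix mm mm ℂ) (U' μ x) (U' μ x)ᴴ))) + scP' d L mv kk r hL (aK a₀ (L : ℝ) (r + kk) * (((L ^ r * L ^ kk : ℕ) : ℝ)) ^ (d + 1)) ι e U') ∘ₗ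
            scGlued' d L mv kk r hL (aK a₀ (L : ℝ) (r + kk) * (((L ^ r * L ^ kk : ℕ) : ℝ)) ^ (d + 1)) ((((L ^ r * L ^ kk : ℕ) : ℝ))⁻¹) ι e u' U' (scP' d L mv kk r hL (aK a₀ (L : ℝ) (r + kk) * (((L ^ r * L ^ kk : ℕ) : ℝ)) ^ (d + 1)) ι e U') (scNV' d L mv kk r hL (aK a₀ (L : ℝ) (r + kk) * (((L ^ r * L ^ kk : ℕ) : ℝ)) ^ (d + 1)) ι e u' U') = LinearMap.id) := by
  obtain ⟨δc, w₀c, R₀c, θ₀c, Bc, hδc, hR₀c, hθ₀c, hBc, Hc⟩ := uN_scGlued_spec (d := d) hL hL7 ha₀ ι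
  obtain ⟨δf, w₀f, R₀f, θ₀f, Bf, hδf, hR₀f, hθ₀f, hBf, Hf⟩ := uN_scGlued'_spec (d := d) hL hL7 ha₀ ι
  have hL1r : (1 : ℝ) < (L : ℝ) := (by exact_mod_cast hL.2); have hL3 : 3 ≤ L := (by omega); have hLpos : 0 < L := (by omega)
  refine ⟨min δc δf, max (max w₀c w₀f) 3, min R₀c R₀f, max Bc Bf, lt_min hδc hδf, lt_min hR₀c hR₀f, lt_max_of_lt_left hBc, fun mv kk r hk hr hw₀ => ?_⟩
  intro mm _ _ _ e he u' hu' U hU U' hU' Qf Qc p q hp hq hQf hQc hF1 hF2 hC1 hC2 rV hrV hrA hrC hRle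
  have hw₀c : w₀c ≤ ((L ^ mv : ℕ) : ℝ) := ((le_max_left _ _).trans (le_max_left _ _)).trans hw₀
  have hw₀f : w₀f ≤ ((L ^ mv : ℕ) : ℝ) := ((le_max_right _ _).trans (le_max_left _ _)).trans hw₀
  have hW3 : 3 ≤ L ^ mv := by have h := (le_max_right (max w₀c w₀f) 3).trans hw₀; exact_mod_cast h
  have hW2 : 2 ≤ L ^ mv := (by omega); have hw : 0 < L ^ mv := (by omega)
  have hη : (0 : ℝ) < ((((L ^ kk : ℕ) : ℝ))⁻¹) := inv_pos.mpr (Nat.cast_pos.mpr (pow_pos hLpos kk))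
  have hη' : (0 : ℝ) < ((((L ^ r * L ^ kk : ℕ) : ℝ))⁻¹) := inv_pos.mpr (Nat.cast_pos.mpr (Nat.mul_pos (pow_pos hLpos r) (pow_pos hLpos kk)))
  have hM : ∀ ν, cvM d L mv kk hL ν = 2 * L * L ^ mv := MP_succ_eq L mv kk hL
  have hm₁ : 2 * L ^ mv ≤ coverMargin L mv := two_mul_le_coverMargin hL7 mv
  have hfitI : coverMargin L mv - 2 * L ^ mv + (6 * L ^ mv + 1) ≤ L * L ^ mv := coverMargin_inner_fit hL7 hW2
  have hS0 : L * L ^ mv ≤ 2 * L * L ^ mv := (by rw [mul_assoc]; omega)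
  have hmg₂ : 2 * L ^ mv + 1 ≤ coverMargin L mv := (coverMargin_cut_margin hL7 hW3).1
  have hfg₂ : coverMargin L mv - 2 * L ^ mv + (6 * L ^ mv + 1) + 1 ≤ L * L ^ mv := (coverMargin_cut_margin hL7 hW3).2
  have hS6 : 6 * L ^ mv + 1 ≤ 2 * L * L ^ mv := by
    have h7 : 7 * L ^ mv ≤ L * L ^ mv := Nat.mul_le_mul_right _ hL7
    have e7 : 2 * L * L ^ mv = 2 * (L * L ^ mv) := by ring
    rw [e7]; omega
  -- King's windows at both indices
  have haK : 0 < aK a₀ (L : ℝ) kk := aK_pos ha₀ hL1r hk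
  have haKle : aK a₀ (L : ℝ) kk ≤ a₀ := aK_le ha₀ hL1r hk
  have ha' : 0 < (aK a₀ (L : ℝ) kk * (((L ^ kk : ℕ) : ℝ)) ^ (d + 1)) := by positivity
  have haK' : 0 < aK a₀ (L : ℝ) (r + kk) := aK_pos ha₀ hL1r (hk.trans (Nat.le_add_left kk r))
  have haKle' : aK a₀ (L : ℝ) (r + kk) ≤ a₀ := aK_le ha₀ hL1r (hk.trans (Nat.le_add_left kk r))
  have ha'' : 0 < (aK a₀ (L : ℝ) (r + kk) * (((L ^ r * L ^ kk : ℕ) : ℝ)) ^ (d + 1)) := by positivity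
  have habs : |(aK a₀ (L : ℝ) kk * (((L ^ kk : ℕ) : ℝ)) ^ (d + 1))| * ((((L ^ kk : ℕ) : ℝ)) ^ (d + 1))⁻¹ = aK a₀ (L : ℝ) kk := by rw [abs_of_pos ha', mul_assoc, mul_inv_cancel₀ (by positivity), mul_one]
  have habs' : |(aK a₀ (L : ℝ) (r + kk) * (((L ^ r * L ^ kk : ℕ) : ℝ)) ^ (d + 1))| * ((((L ^ r * L ^ kk : ℕ) : ℝ)) ^ (d + 1))⁻¹ = aK a₀ (L : ℝ) (r + kk) := by rw [abs_of_pos ha'', mul_assoc, mul_inv_cancel₀ (by positivity), mul_one]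
  -- the letters of the cut rows
  have hσc0 : 0 ≤ ((1 + rV * ((((L ^ kk : ℕ) : ℝ))⁻¹)) ^ ((d + 1) * L ^ kk) - 1) := by
    have := one_le_pow₀ (M₀ := ℝ) (a := 1 + rV * ((((L ^ kk : ℕ) : ℝ))⁻¹)) (by nlinarith [hη.le]) (n := (d + 1) * L ^ kk); linarith
  have hσf0 : 0 ≤ ((1 + rV * ((((L ^ r * L ^ kk : ℕ) : ℝ))⁻¹)) ^ ((d + 1) * (L ^ r * L ^ kk)) - 1) := by
    have := one_le_pow₀ (M₀ := ℝ) (a := 1 + rV * ((((L ^ r * L ^ kk : ℕ) : ℝ))⁻¹)) (by nlinarith [hη'.le]) (n := (d + 1) * (L ^ r * L ^ kk)); linarith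
  have hSc0 : 0 ≤ (Fintype.card ι * (Fintype.card ι * ((1 + rV * ((((L ^ kk : ℕ) : ℝ))⁻¹)) ^ ((d + 1) * L ^ kk) - 1) ^ 2 + 2 * ((1 + rV * ((((L ^ kk : ℕ) : ℝ))⁻¹)) ^ ((d + 1) * L ^ kk) - 1))) := (by positivity); have hSf0 : 0 ≤ (Fintype.card ι * (Fintype.card ι * ((1 + rV * ((((L ^ r * L ^ kk : ℕ) : ℝ))⁻¹)) ^ ((d + 1) * (L ^ r * L ^ kk)) - 1) ^ 2 + 2 * ((1 + rV * ((((L ^ r * L ^ kk : ℕ) : ℝ))⁻¹)) ^ ((d + 1) * (L ^ r * L ^ kk)) - 1))) := (by positivity)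
  have hRN0 : 0 ≤ a₀ * (Fintype.card ι * (Fintype.card ι * ((1 + rV * ((((L ^ kk : ℕ) : ℝ))⁻¹)) ^ ((d + 1) * L ^ kk) - 1) ^ 2 + 2 * ((1 + rV * ((((L ^ kk : ℕ) : ℝ))⁻¹)) ^ ((d + 1) * L ^ kk) - 1))) + a₀ * (Fintype.card ι * (Fintype.card ι * ((1 + rV * ((((L ^ r * L ^ kk : ℕ) : ℝ))⁻¹)) ^ ((d + 1) * (L ^ r * L ^ kk)) - 1) ^ 2 + 2 * ((1 + rV * ((((L ^ r * L ^ kk : ℕ) : ℝ))⁻¹)) ^ ((d + 1) * (L ^ r * L ^ kk)) - 1))) := by positivity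
  -- the induced coarse gauge, the transformed bond variables, unitarity ∕ orthogonality
  have hW : ∀ (k : Fin (d + 1) → ZMod (2 * L)) (x : ScX d L mv kk hL), ((fun k x => u' k (kingSec (cvM d L mv kk hL) L kk r x)) k x)ᴴ * (fun k x => u' k (kingSec (cvM d L mv kk hL) L kk r x)) k x = 1 := fun k x => hu' k _
  have hV'u : ∀ (k : Fin (d + 1) → ZMod (2 * L)) (μ : Fin (d + 1)) (z : ScX' d L mv kk r hL), (u' k z * U' μ z * (u' k (scShift' d L mv kk r hL μ z))ᴴ)ᴴ * (u' k z * U' μ z * (u' k (scShift' d L mv kk r hL μ z))ᴴ) = 1 := fun k μ z => uN_gaugeTransformed_bond_unitary (scShift' d L mv kk r hL) (u' k) U' (hu' k) hU' μ z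
  have hVu : ∀ (k : Fin (d + 1) → ZMod (2 * L)) (μ : Fin (d + 1)) (x : ScX d L mv kk hL), (u' k (kingSec (cvM d L mv kk hL) L kk r x) * U μ x * (u' k (kingSec (cvM d L mv kk hL) L kk r (scShift d L mv kk hL μ x)))ᴴ)ᴴ * (u' k (kingSec (cvM d L mv kk hL) L kk r x) * U μ x * (u' k (kingSec (cvM d L mv kk hL) L kk r (scShift d L mv kk hL μ x)))ᴴ) = 1 := fun k μ x => uN_gaugeTransformed_bond_unitary (scShift d L mv kk hL) ((fun k x => u' k (kingSec (cvM d L mv kk hL) L kk r x)) k) U (hW k) hU μ x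
  have hκ0 : 0 ≤ @basisConst ι _ (Matrix mm mm ℂ) Matrix.frobeniusNormedAddCommGroup Matrix.frobeniusNormedSpace e * (2 * Real.sqrt (Fintype.card mm)) := mul_nonneg (@basisConst_nonneg ι _ (Matrix mm mm ℂ) Matrix.frobeniusNormedAddCommGroup Matrix.frobeniusNormedSpace e) (by positivity)
  have hP10 : 0 ≤ (@basisConst ι _ (Matrix mm mm ℂ) Matrix.frobeniusNormedAddCommGroup Matrix.frobeniusNormedSpace e * (2 * Real.sqrt (Fintype.card mm)) * (Real.sqrt (Fintype.card mm) * p)) := by positivity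
  -- the entry letters (dag-n15-w2 §2), both grids
  have hE1' : ∀ (k : Fin (d + 1) → ZMod (2 * L)) (μ : Fin (d + 1)) (z : ScX' d L mv kk r hL), z ∈ Qf k → ∀ i j, |((fun μ x' => coordMat e (ContinuousLinearMap.mulLeftRight ℝ (Matrix mm mm ℂ) (u' k x' * U' μ x' * (u' k (scShift' d L mv kk r hL μ x'))ᴴ) (u' k x' * U' μ x' * (u' k (scShift' d L mv kk r hL μ x'))ᴴ)ᴴ)) μ z - 1) i j| ≤ ((((L ^ r * L ^ kk : ℕ) : ℝ))⁻¹) * (@basisConst ι _ (Matrix mm mm ℂ) Matrix.frobeniusNormedAddCommGroup Matrix.frobeniusNormedSpace e * (2 * Real.sqrt (Fintype.card mm)) * (Real.sqrt (Fintype.card mm) * p)) := fun k μ z hz i j => by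
    refine (uN_abs_coordMat_conj_sub_one_entry_le_op e (hV'u k μ z) i j).trans ?_
    calc @basisConst ι _ (Matrix mm mm ℂ) Matrix.frobeniusNormedAddCommGroup Matrix.frobeniusNormedSpace e * (2 * Real.sqrt (Fintype.card mm)) * (Real.sqrt (Fintype.card mm) * ‖(u' k z * U' μ z * (u' k (scShift' d L mv kk r hL μ z))ᴴ) - 1‖) ≤ @basisConst ι _ (Matrix mm mm ℂ) Matrix.frobeniusNormedAddCommGroup Matrix.frobeniusNormedSpace e * (2 * Real.sqrt (Fintype.card mm)) * (Real.sqrt (Fintype.card mm) * (((((L ^ r * L ^ kk : ℕ) : ℝ))⁻¹) * p)) := by gcongr; exact hF1 k μ z hz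
      _ = ((((L ^ r * L ^ kk : ℕ) : ℝ))⁻¹) * (@basisConst ι _ (Matrix mm mm ℂ) Matrix.frobeniusNormedAddCommGroup Matrix.frobeniusNormedSpace e * (2 * Real.sqrt (Fintype.card mm)) * (Real.sqrt (Fintype.card mm) * p)) := by ring
  have hE2' : ∀ (k : Fin (d + 1) → ZMod (2 * L)) (μ : Fin (d + 1)) (z : ScX' d L mv kk r hL), z ∈ Qf k → ∀ i j, |((fun μ x' => coordMat e (ContinuousLinearMap.mulLeftRight ℝ (Matrix mm mm ℂ) (u' k x' * U' μ x' * (u' k (scShift' d L mv kk r hL μ x'))ᴴ) (u' k x' * U' μ x' * (u' k (scShift' d L mv kk r hL μ x'))ᴴ)ᴴ)) μ z - (fun μ x' => coordMat e (ContinuousLinearMap.mulLeftRight ℝ (Matrix mm mm ℂ) (u' k x' * U' μ x' * (u' k (scShift' d L mv kk r hL μ x'))ᴴ) (u' k x' * U' μ x' * (u' k (scShift' d L mv kk r hL μ x'))ᴴ)ᴴ)) μ ((scShift' d L mv kk r hL μ).symm z)) i j| ≤ ((((L ^ r * L ^ kk : ℕ) : ℝ))⁻¹) ^ 2 * (@basisConst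 ι _ (Matrix mm mm ℂ) Matrix.frobeniusNormedAddCommGroup Matrix.frobeniusNormedSpace e * (2 * Real.sqrt (Fintype.card mm)) * (Real.sqrt (Fintype.card mm) * q)) := fun k μ z hz i j => by
    refine (uN_abs_coordMat_conj_sub_conj_entry_le_op e (hV'u k μ ((scShift' d L mv kk r hL μ).symm z)) (hV'u k μ z) i j).trans ?_
    calc @basisConst ι _ (Matrix mm mm ℂ) Matrix.frobeniusNormedAddCommGroup Matrix.frobeniusNormedSpace e * (2 * Real.sqrt (Fintype.card mm)) * (Real.sqrt (Fintype.card mm) * ‖(u' k z * U' μ z * (u' k (scShift' d L mv kk r hL μ z))ᴴ) - (u' k ((scShift' d L mv kk r hL μ).symm z) * U' μ ((scShift' d L mv kk r hL μ).symm z) * (u' k (scShift' d L mv kk r hL μ ((scShift' d L mv kk r hL μ).symm z)))ᴴ)‖) ≤ @basisConst ι _ (Matrix mm mm ℂ) Matrix.frobeniusNormedAddCommGroup Matrix.frobeniusNormedSpace e * (2 * Real.sqrt (Fintype.card mm)) * (Real.sqrt (Fintype.card mm) * (((((L ^ r * L ^ kk : ℕ) : ℝ))⁻¹) ^ 2 *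 q)) := by gcongr; exact hF2 k μ z hz
      _ = ((((L ^ r * L ^ kk : ℕ) : ℝ))⁻¹) ^ 2 * (@basisConst ι _ (Matrix mm mm ℂ) Matrix.frobeniusNormedAddCommGroup Matrix.frobeniusNormedSpace e * (2 * Real.sqrt (Fintype.card mm)) * (Real.sqrt (Fintype.card mm) * q)) := by ring
  have hE1 : ∀ (k : Fin (d + 1) → ZMod (2 * L)) (μ : Fin (d + 1)) (x : ScX d L mv kk hL), x ∈ Qc k → ∀ i j, |((fun μ x => coordMat e (ContinuousLinearMap.mulLeftRight ℝ (Matrix mm mm ℂ) (u' k (kingSec (cvM d L mv kk hL) L kk r x) * U μ x * (u' k (kingSec (cvM d L mv kk hL) L kk r (scShift d L mv kk hL μ x)))ᴴ) (u' k (kingSec (cvM d L mv kk hL) L kk r x) * U μ x * (u' k (kingSec (cvM d L mv kk hL) L kk r (scShift d L mv kk hL μ x)))ᴴ)ᴴ)) μ x - 1) i j| ≤ ((((L ^ kk : ℕ) : ℝ))⁻¹) * (@basisConst ι _ (Matrix mm mm ℂ) Matrix.frobeniusNormedAddCommGroup Matrix.frobeniusNormedSpace e * (2 * Real.sqrt (Fintype.card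 mm)) * (Real.sqrt (Fintype.card mm) * p)) := fun k μ x hx i j => by
    refine (uN_abs_coordMat_conj_sub_one_entry_le_op e (hVu k μ x) i j).trans ?_
    calc @basisConst ι _ (Matrix mm mm ℂ) Matrix.frobeniusNormedAddCommGroup Matrix.frobeniusNormedSpace e * (2 * Real.sqrt (Fintype.card mm)) * (Real.sqrt (Fintype.card mm) * ‖(u' k (kingSec (cvM d L mv kk hL) L kk r x) * U μ x * (u' k (kingSec (cvM d L mv kk hL) L kk r (scShift d L mv kk hL μ x)))ᴴ) - 1‖) ≤ @basisConst ι _ (Matrix mm mm ℂ) Matrix.frobeniusNormedAddCommGroup Matrix.frobeniusNormedSpace e * (2 * Real.sqrt (Fintype.card mm)) * (Real.sqrt (Fintype.card mm) * (((((L ^ kk : ℕ) : ℝ))⁻¹) * p)) := by gcongr; exact hC1 k μ x hx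
      _ = ((((L ^ kk : ℕ) : ℝ))⁻¹) * (@basisConst ι _ (Matrix mm mm ℂ) Matrix.frobeniusNormedAddCommGroup Matrix.frobeniusNormedSpace e * (2 * Real.sqrt (Fintype.card mm)) * (Real.sqrt (Fintype.card mm) * p)) := by ring
  have hE2 : ∀ (k : Fin (d + 1) → ZMod (2 * L)) (μ : Fin (d + 1)) (x : ScX d L mv kk hL), x ∈ Qc k → ∀ i j, |((fun μ x => coordMat e (ContinuousLinearMap.mulLeftRight ℝ (Matrix mm mm ℂ) (u' k (kingSec (cvM d L mv kk hL) L kk r x) * U μ x * (u' k (kingSec (cvM d L mv kk hL) L kk r (scShift d L mv kk hL μ x)))ᴴ) (u' k (kingSec (cvM d L mv kk hL) L kk r x) * U μ x * (u' k (kingSec (cvM d L mv kk hL) L kk r (scShift d L mv kk hL μ x)))ᴴ)ᴴ)) μ x - (fun μ x => coordMat e (ContinuousLinearMap.mulLeftRight ℝ (Matrix mm mm ℂ) (u' k (kingSec (cvM d L mv kk hL) L kk r x) * U μ x * (u' k (kingSec (cvM d L mv kk hL) L kk r (scShift d L mv kk hL μ x)))ᴴ) (u' k (kingSec (cvM d L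 mv kk hL) L kk r x) * U μ x * (u' k (kingSec (cvM d L mv kk hL) L kk r (scShift d L mv kk hL μ x)))ᴴ)ᴴ)) μ ((scShift d L mv kk hL μ).symm x)) i j| ≤ ((((L ^ kk : ℕ) : ℝ))⁻¹) ^ 2 * (@basisConst ι _ (Matrix mm mm ℂ) Matrix.frobeniusNormedAddCommGroup Matrix.frobeniusNormedSpace e * (2 * Real.sqrt (Fintype.card mm)) * (Real.sqrt (Fintype.card mm) * q)) := fun k μ x hx i j => by
    refine (uN_abs_coordMat_conj_sub_conj_entry_le_op e (hVu k μ ((scShift d L mv kk hL μ).symm x)) (hVu k μ x) i j).trans ?_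
    calc @basisConst ι _ (Matrix mm mm ℂ) Matrix.frobeniusNormedAddCommGroup Matrix.frobeniusNormedSpace e * (2 * Real.sqrt (Fintype.card mm)) * (Real.sqrt (Fintype.card mm) * ‖(u' k (kingSec (cvM d L mv kk hL) L kk r x) * U μ x * (u' k (kingSec (cvM d L mv kk hL) L kk r (scShift d L mv kk hL μ x)))ᴴ) - (u' k (kingSec (cvM d L mv kk hL) L kk r ((scShift d L mv kk hL μ).symm x)) * U μ ((scShift d L mv kk hL μ).symm x) * (u' k (kingSec (cvM d L mv kk hL) L kk r (scShift d L mv kk hL μ ((scShift d L mv kk hL μ).symm x))))ᴴ)‖) ≤ @basisConst ι _ (Matrix mm mm ℂ) Matrix.frobeniusNormedAddCommGroup Matrix.frobeniusNormedSpace e * (2 * Real.sqrt (Fintype.card mm)) * (Real.sqrt (Fintype.card mm) * (((((L ^ kk : ℕ) : ℝ))⁻¹) ^ 2 * q)) := by gcongr; exact hC2 k μ x hx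
      _ = ((((L ^ kk : ℕ) : ℝ))⁻¹) ^ 2 * (@basisConst ι _ (Matrix mm mm ℂ) Matrix.frobeniusNormedAddCommGroup Matrix.frobeniusNormedSpace e * (2 * Real.sqrt (Fintype.card mm)) * (Real.sqrt (Fintype.card mm) * q)) := by ring
  have hSo' : ∀ (k : Fin (d + 1) → ZMod (2 * L)) (μ : Fin (d + 1)) (z : ScX' d L mv kk r hL), (fun μ x' => coordMat e (ContinuousLinearMap.mulLeftRight ℝ (Matrix mm mm ℂ) (u' k x' * U' μ x' * (u' k (scShift' d L mv kk r hL μ x'))ᴴ) (u' k x' * U' μ x' * (u' k (scShift' d L mv kk r hL μ x'))ᴴ)ᴴ)) μ z * ((fun μ x' => coordMat e (ContinuousLinearMap.mulLeftRight ℝ (Matrix mm mm ℂ) (u' k x' * U' μ x' * (u' k (scShift' d L mv kk r hL μ x'))ᴴ) (u' k x' * U' μ x' * (u' k (scShift' d L mv kk r hL μ x'))ᴴ)ᴴ)) μ z)ᵀ = 1 := fun k μ z => (uN_coordMat_conj_orthogonal e he (hV'u k μ z)).2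
  have hSo : ∀ (k : Fin (d + 1) → ZMod (2 * L)) (μ : Fin (d + 1)) (x : ScX d L mv kk hL), (fun μ x => coordMat e (ContinuousLinearMap.mulLeftRight ℝ (Matrix mm mm ℂ) (u' k (kingSec (cvM d L mv kk hL) L kk r x) * U μ x * (u' k (kingSec (cvM d L mv kk hL) L kk r (scShift d L mv kk hL μ x)))ᴴ) (u' k (kingSec (cvM d L mv kk hL) L kk r x) * U μ x * (u' k (kingSec (cvM d L mv kk hL) L kk r (scShift d L mv kk hL μ x)))ᴴ)ᴴ)) μ x * ((fun μ x => coordMat e (ContinuousLinearMap.mulLeftRight ℝ (Matrix mm mm ℂ) (u' k (kingSec (cvM d L mv kk hL) L kk r x) * U μ x * (u' k (kingSec (cvM d L mv kk hL) L kk r (scShift d L mv kk hL μ x)))ᴴ) (u' k (kingSec (cvM d L mv kk hL) L kk r x) * U μ x * (u' k (kingSec (cvM d L mv kk hL) L kk r (scShift d L mv kk hL μ x)))ᴴ)ᴴ)) μ x)ᵀ = 1 := fun k μ x => (uN_coordMat_conj_orthogonal e he (hVu k μ x)).2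
  -- 339's coefficient letters `hCloc hAloc hCloc′ hAloc′` (dag-n15-w2 §1, pointwise)
  have hAloc' : ∀ k j' x', scChi' d L mv kk r hL k x' ≠ 0 → ∀ i, ∑ j, |tCoefA ((((L ^ r * L ^ kk : ℕ) : ℝ))⁻¹) (gaugePair (scShift' d L mv kk r hL) (fun μ x' => coordMat e (ContinuousLinearMap.mulLeftRight ℝ (Matrix mm mm ℂ) (u' k x' * U' μ x' * (u' k (scShift' d L mv kk r hL μ x'))ᴴ) (u' k x' * U' μ x' * (u' k (scShift' d L mv kk r hL μ x'))ᴴ)ᴴ))) j' x' i j| ≤ rV := fun k j' x' hx' i => by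
    obtain ⟨h0, h2⟩ := hQf k x' hx'
    cases j' with
    | inl μ => exact (rowSum_tCoefA_inl_le_at ((((L ^ r * L ^ kk : ℕ) : ℝ))⁻¹) (scShift' d L mv kk r hL) _ hη' (hE1' k μ x' h0) i).trans hrA
    | inr μ => exact (rowSum_tCoefA_inr_le_at ((((L ^ r * L ^ kk : ℕ) : ℝ))⁻¹) (scShift' d L mv kk r hL) _ hη' (hE1' k μ _ (h2 μ)) i).trans hrA
  have hCloc' : ∀ k x', scChi' d L mv kk r hL k x' ≠ 0 → ∀ i, ∑ j, |tCoefC ((((L ^ r * L ^ kk : ℕ) : ℝ))⁻¹) (gaugePair (scShift' d L mv kk r hL) (fun μ x' => coordMat e (ContinuousLinearMap.mulLeftRight ℝ (Matrix mm mm ℂ) (u' k x' * U' μ x' * (u' k (scShift' d L mv kk r hL μ x'))ᴴ) (u' k x' * U' μ x' * (u' k (scShift' d L mv kk r hL μ x'))ᴴ)ᴴ))) x' i j| ≤ rV := fun k x' hx' i =>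
    (rowSum_tCoefC_le_at ((((L ^ r * L ^ kk : ℕ) : ℝ))⁻¹) (scShift' d L mv kk r hL) _ hη' hP10 (hSo' k) (fun μ => hE1' k μ x' (hQf k x' hx').1) (fun μ => hE2' k μ x' (hQf k x' hx').1) i).trans hrC
  have hAloc : ∀ k j' x, scChi d L mv kk hL k x ≠ 0 → ∀ i, ∑ j, |tCoefA ((((L ^ kk : ℕ) : ℝ))⁻¹) (gaugePair (scShift d L mv kk hL) (fun μ x => coordMat e (ContinuousLinearMap.mulLeftRight ℝ (Matrix mm mm ℂ) (u' k (kingSec (cvM d L mv kk hL) L kk r x) * U μ x * (u' k (kingSec (cvM d L mv kk hL) L kk r (scShift d L mv kk hL μ x)))ᴴ) (u' k (kingSec (cvM d L mv kk hL) L kk r x) * U μ x * (u' k (kingSec (cvM d L mv kk hL) L kk r (scShift d L mv kk hL μ x)))ᴴ)ᴴ))) j' x i j| ≤ rV := fun k j' x hx i => by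
    obtain ⟨h0, h2⟩ := hQc k x hx
    cases j' with
    | inl μ => exact (rowSum_tCoefA_inl_le_at ((((L ^ kk : ℕ) : ℝ))⁻¹) (scShift d L mv kk hL) _ hη (hE1 k μ x h0) i).trans hrA
    | inr μ => exact (rowSum_tCoefA_inr_le_at ((((L ^ kk : ℕ) : ℝ))⁻¹) (scShift d L mv kk hL) _ hη (hE1 k μ _ (h2 μ)) i).trans hrA
  have hCloc : ∀ k x, scChi d L mv kk hL k x ≠ 0 → ∀ i, ∑ j, |tCoefC ((((L ^ kk : ℕ) : ℝ))⁻¹) (gaugePair (scShift d L mv kk hL) (fun μ x => coordMat e (ContinuousLinearMap.mulLeftRight ℝ (Matrix mm mm ℂ) (u' k (kingSec (cvM d L mv kk hL) L kk r x) * U μ x * (u' k (kingSec (cvM d L mv kk hL) L kk r (scShift d L mv kk hL μ x)))ᴴ) (u' k (kingSec (cvM d L mv kk hL) L kk r x) * U μ x * (u' k (kingSec (cvM d L mv kk hL) L kk r (scShift d L mv kk hL μ x)))ᴴ)ᴴ))) x i j| ≤ rV := fun k x hx i =>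
    (rowSum_tCoefC_le_at ((((L ^ kk : ℕ) : ℝ))⁻¹) (scShift d L mv kk hL) _ hη hP10 (hSo k) (fun μ => hE1 k μ x (hQc k x hx).1) (fun μ => hE2 k μ x (hQc k x hx).1) i).trans hrC
  -- the thresholds of 262 ∕ 262′ from the displayed one
  have hRlec : rV * (1 + Fintype.card (Fin (d + 1) ⊕ Fin (d + 1))) + aK a₀ (L : ℝ) kk * (Fintype.card ι * (Fintype.card ι * ((1 + rV * ((((L ^ kk : ℕ) : ℝ))⁻¹)) ^ ((d + 1) * L ^ kk) - 1) ^ 2 + 2 * ((1 + rV * ((((L ^ kk : ℕ) : ℝ))⁻¹)) ^ ((d + 1) * L ^ kk) - 1))) ≤ R₀c := by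
    have h1 := mul_le_mul_of_nonneg_right haKle hSc0; have h2 := mul_nonneg ha₀.le hSf0; have h3 := min_le_left R₀c R₀f; linarith
  have hRlef : rV * (1 + Fintype.card (Fin (d + 1) ⊕ Fin (d + 1))) + aK a₀ (L : ℝ) (r + kk) * (Fintype.card ι * (Fintype.card ι * ((1 + rV * ((((L ^ r * L ^ kk : ℕ) : ℝ))⁻¹)) ^ ((d + 1) * (L ^ r * L ^ kk)) - 1) ^ 2 + 2 * ((1 + rV * ((((L ^ r * L ^ kk : ℕ) : ℝ))⁻¹)) ^ ((d + 1) * (L ^ r * L ^ kk)) - 1))) ≤ R₀f := by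
    have h1 := mul_le_mul_of_nonneg_right haKle' hSf0; have h2 := mul_nonneg ha₀.le hSc0; have h3 := min_le_right R₀c R₀f; linarith
  have hRNc0 : 0 ≤ aK a₀ (L : ℝ) kk * (Fintype.card ι * (Fintype.card ι * ((1 + rV * ((((L ^ kk : ℕ) : ℝ))⁻¹)) ^ ((d + 1) * L ^ kk) - 1) ^ 2 + 2 * ((1 + rV * ((((L ^ kk : ℕ) : ℝ))⁻¹)) ^ ((d + 1) * L ^ kk) - 1))) := mul_nonneg haK.le hSc0
  have hRNf0 : 0 ≤ aK a₀ (L : ℝ) (r + kk) * (Fintype.card ι * (Fintype.card ι * ((1 + rV * ((((L ^ r * L ^ kk : ℕ) : ℝ))⁻¹)) ^ ((d + 1) * (L ^ r * L ^ kk)) - 1) ^ 2 + 2 * ((1 + rV * ((((L ^ r * L ^ kk : ℕ) : ℝ))⁻¹)) ^ ((d + 1) * (L ^ r * L ^ kk)) - 1))) := mul_nonneg haK'.le hSf0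
  -- the decay weights: `e^{−(δ_c∕16)d} ≤ e^{−(δ∕16)d}`, `B_c ≤ B` (and the same for the fine block)
  have hexp : ∀ (t Bt : ℝ) (y y' : Tor (cvM d L mv kk hL)), min δc δf ≤ t → Bt ≤ max Bc Bf → 0 ≤ Bt →
      Bt * Real.exp (-(t / 16 * (unitTorusGeo L kk (cvM d L mv kk hL)).dist y y')) ≤ max Bc Bf * Real.exp (-(min δc δf / 16 * (unitTorusGeo L kk (cvM d L mv kk hL)).dist y y')) := by
    intro t Bt y y' ht hBt hBt0
    have hd : 0 ≤ (unitTorusGeo L kk (cvM d L mv kk hL)).dist y y' := unitTorusGeo_dist_nonneg (M := cvM d L mv kk hL) L kk y y'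
    refine mul_le_mul hBt (Real.exp_le_exp.mpr ?_) (Real.exp_nonneg _) (hBt0.trans hBt)
    nlinarith
  -- 262 (coarse, INDUCED gauges) and 262′ (fine)
  have HC := Hc mv kk hk hw₀c e he (fun k x => u' k (kingSec (cvM d L mv kk hL) L kk r x)) hW U (scP d L mv kk hL (aK a₀ (L : ℝ) kk * (((L ^ kk : ℕ) : ℝ)) ^ (d + 1)) ι e U) (scNV d L mv kk hL (aK a₀ (L : ℝ) kk * (((L ^ kk : ℕ) : ℝ)) ^ (d + 1)) ι e (fun k x => u' k (kingSec (cvM d L mv kk hL) L kk r x)) U) rV (aK a₀ (L : ℝ) kk * (Fintype.card ι * (Fintype.card ι * ((1 + rV * ((((L ^ kk : ℕ) : ℝ))⁻¹)) ^ ((d + 1) * L ^ kk) - 1) ^ 2 + 2 * ((1 + rV * ((((L ^ kk : ℕ) : ℝ))⁻¹)) ^ ((d + 1) * L ^ kk) - 1)))) 0 hrV hRNc0 le_rfl hRlec hθ₀c.le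
    (fun k => scP_conj ι e (aK a₀ (L : ℝ) kk * (((L ^ kk : ℕ) : ℝ)) ^ (d + 1)) (fun k x => u' k (kingSec (cvM d L mv kk hL) L kk r x)) U k) hCloc hAloc
    (fun k => (hasMaj_scNV_cut_of_rows ι e he (aK a₀ (L : ℝ) kk * (((L ^ kk : ℕ) : ℝ)) ^ (d + 1)) hW U hrV k (fun μ x hx i => hAloc k (Sum.inl μ) x hx i) δc).mono fun y y' =>
      mul_le_mul_of_nonneg_right (le_of_eq (by rw [habs])) (Real.exp_nonneg _))
    (fun k => by
      rw [one_sub_scPsi_comp_scNV_comp_scChi ι e he hM hm₁ hfitI hS0 (aK a₀ (L : ℝ) kk * (((L ^ kk : ℕ) : ℝ)) ^ (d + 1)) hW U k]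
      exact (hasMaj_zero _ _).mono fun y y' => by positivity)
  have HF := Hf mv kk r hk hr hw₀f e he u' hu' U' (scP' d L mv kk r hL (aK a₀ (L : ℝ) (r + kk) * (((L ^ r * L ^ kk : ℕ) : ℝ)) ^ (d + 1)) ι e U') (scNV' d L mv kk r hL (aK a₀ (L : ℝ) (r + kk) * (((L ^ r * L ^ kk : ℕ) : ℝ)) ^ (d + 1)) ι e u' U') rV (aK a₀ (L : ℝ) (r + kk) * (Fintype.card ι * (Fintype.card ι * ((1 + rV * ((((L ^ r * L ^ kk : ℕ) : ℝ))⁻¹)) ^ ((d + 1) * (L ^ r * L ^ kk)) - 1) ^ 2 + 2 * ((1 + rV * ((((L ^ r * L ^ kk : ℕ) : ℝ))⁻¹)) ^ ((d + 1) * (L ^ r * L ^ kk)) - 1)))) 0 hrV hRNf0 le_rfl hRlef hθ₀f.le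
    (fun k => scP'_conj ι e (aK a₀ (L : ℝ) (r + kk) * (((L ^ r * L ^ kk : ℕ) : ℝ)) ^ (d + 1)) u' U' k) hCloc' hAloc'
    (fun k => (hasMaj_scNV'_cut_of_rows ι e he (aK a₀ (L : ℝ) (r + kk) * (((L ^ r * L ^ kk : ℕ) : ℝ)) ^ (d + 1)) hu' U' hrV k (fun μ x hx i => hAloc' k (Sum.inl μ) x hx i) δf).mono fun y y' =>
      mul_le_mul_of_nonneg_right (le_of_eq (by rw [habs'])) (Real.exp_nonneg _))
    (fun k => by
      rw [one_sub_scPsi'_comp_scNV'_comp_scChi' ι e he hM hm₁ hfitI hS0 (aK a₀ (L : ℝ) (r + kk) * (((L ^ r * L ^ kk : ℕ) : ℝ)) ^ (d + 1)) hu' U' k]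
      exact (hasMaj_zero _ _).mono fun y y' => by positivity)
  exact ⟨⟨HC.1.mono fun y y' => hexp δc Bc y y' (min_le_left _ _) (le_max_left _ _) hBc.le, HC.2.1, HC.2.2⟩,
    ⟨HF.1.mono fun y y' => hexp δf Bf y y' (min_le_right _ _) (le_max_right _ _) hBf.le, HF.2.1, HF.2.2⟩⟩

end Green

end Summit.QuantumFields.YangMills.BalabanUVNodes.N15.Gluing

end
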